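import Summits.HodgeConjecture.HodgeConjecture.Theorems.MarkmanPartnerTransportPicardThreeK3SquaresIsogenousRepresentative
import Summits.HodgeConjecture.HodgeConjecture.Theorems.MarkmanPartnerTransportPicardThreeK3SquaresNikulinLattice
import Summits.HodgeConjecture.HodgeConjecture.Theorems.AnchorTransportAnchorExistenceK3SquareCMFloor
import Literature.AlgebraicGeometry.Surfaces.K3NikulinInvolutionInvariantLattice
import Literature.AlgebraicGeometry.HodgeTheory.SupportedClassesHodgeConiveauHolds
import Literature.AlgebraicGeometry.HodgeTheory.LefschetzOneOneHolds
import Literature.AlgebraicGeometry.HodgeTheory.HodgeIndexPrimitiveAlgebraicHolds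

/-!
# Route MarkmanPartnerTransport · crux `PicardThreeK3Squares` (stmt-HodgeConjecture-19652) —
# every projective K3 surface of Picard rank `≥ 11` is ISOGENOUS to a marked projective K3 surface
# whose Néron–Severi lattice contains the anti-invariant `E₈(−2)` of the model Nikulin involution
# (modulo the surjectivity of the period map)

Assembly of `…NikulinLattice` (every non-degenerate subspace `T ⊂ Λ_ℚ` of dimension `≤ 11` is moved by
a rational isometry of `Λ_ℚ` into `M = (E₈(−2)_{antidiag})^⊥`) with `…IsogenousRepresentative` (every
rational isometry `σ` of `Λ_ℂ` is realised by a marked projective K3 surface at the period `σ x`, mod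
`Huybrechts_K3_periodSurjective_projective`). For a marked projective K3 surface `(S, η, p, x)` with
`ρ(S) ≥ 11`, read `N_ℚ = η(N¹H²(S)) ∩ Λ_ℚ` (the rational `(1,1)`-vectors: Lefschetz `(1,1)` and
`N¹ ⊆ H^{1,1}`) and `T = N_ℚ^⊥ ⊂ Λ_ℚ` (dimension `22 − dim N_ℚ ≤ 11`, non-degenerate by the Hodge index
theorem, and `x ∈ T ⊗ ℂ`); move `T` into `M` by `σ₀ ∈ O(Λ_ℚ)`; the marked projective K3 surface
`(S', η', p', σ₀ x)` is ISOGENOUS to `S` (along `σ₀⁻¹`), and the anti-diagonal `E₈(−2) = {(y, −y; 0)}`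
— the anti-invariant lattice `nikulinAntiInvariant` of the model Nikulin involution
(`K3NikulinInvolutionInvariantLattice.lean`: primitive, `≅ E₈(−2)`) — is orthogonal to `σ₀ x` and to
`\overline{σ₀ x}`, hence consists of integral `(1,1)`-classes of `S'`, i.e. lies in `NS(S')`
(Lefschetz `(1,1)`).

* `exists_isogenous_antiInvariant_algebraic` — **the theorem**: for `(S, η, p, x)` marked projective
  with `ρ(S) ≥ 11` there are a marked projective K3 surface `(S', η', p', x')`, a rational isometry `σ`
  of `(Λ_ℂ, k3Form)` with `σ x' = x` (so `HodgeConjectureFor 4 (S ⊗ S) ↔ HodgeConjectureFor 4 (S' ⊗ S')`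
  by `IsogenyInvariance.hodgeConjectureFor_square_iff_of_markedIsometry`), and
  `η'⁻¹(v) ∈ algebraicClasses S' 1` for every `v ∈ nikulinAntiInvariant`.

With van Geemen–Sarti's criterion («`E₈(−2) ↪ NS(X)` primitively ⟹ `X` admits a Nikulin involution»,
Nikulin 1979 Thm. 4.3; the downstream file) this is «every projective K3 surface with `ρ ≥ 11` is
isogenous to a K3 surface with a Nikulin involution» — Varesco 2023 Prop. 2.5 with its lattice
hypothesis `T(X) ↪ U³_ℚ ⊕ E₈(−2)_ℚ` discharged by Kitaoka's codimension-`3` theorem.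

No definition, no sorry; named-fact hypothesis `Huybrechts_K3_periodSurjective_projective` only.
Prover seat hodge-nonav-19652-p1 (gen 3), `--supports stmt-HodgeConjecture-19652`.

References: M. Varesco, Math. Z. 305 (2023), §2 Prop. 2.5 (and its proof: saturation + surjectivity
of the period map); B. van Geemen, A. Sarti, Math. Z. 255 (2007), §1.3, §2.1; Y. Kitaoka, *Arithmetic
of Quadratic Forms*, Cor. 4.1.4; D. Huybrechts, *Lectures on K3 Surfaces*, Ch. 3 Lemma 3.3.1, Ch. 6
Prop. 1.2, Rem. 3.3, Ch. 7 Thm. 4.1.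
-/

set_option linter.dupNamespace false

noncomputable section

namespace Summit.HodgeConjecture.HodgeConjecture.Theorems.MarkmanPartnerTransport.NikulinIsogeny

open scoped TensorProduct
open Module CategoryTheory MonoidalCategory
open Literature.AlgebraicGeometry Literature.AlgebraicGeometry.Motives Literature.AlgebraicGeometry.HodgeTheory
open Literature.AlgebraicGeometry.Surfaces
open Literature.AlgebraicTopology.SingularHomology
open Summit.HodgeConjecture.HodgeConjecture.Theorems
open Summit.HodgeConjecture.HodgeConjecture.Theorems.NikulinTwinTransport
open Summit.HodgeConjecture.HodgeConjecture.Theorems.AnchorExistenceCMFloor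
open Summit.HodgeConjecture.HodgeConjecture.Theorems.MarkmanPartnerTransport.IsogenyInvariance

variable {S : SchemeOver ℂ}

/-- `MarkedK3[S, η, p, x]`: VERBATIM the `let MarkedK3 := …` binder of the route declaration
`PicardThreeK3Squares`. Local notation only. -/
local notation3 (prettyPrint := false) "MarkedK3[" S ", " η ", " p ", " x "]" =>
  (p ≠ 0 ∧ (IsIntegralClass p ∧
    (∀ q : complexBetti S (2 * 2), IsIntegralClass q → ∃ n : ℤ, q = n • p) ∧
    (∀ c : complexBetti S (2 * 1), IsIntegralClass c ↔ ∃ v : K3Index → ℤ, η c = fun i => (v i : ℂ)) ∧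
    (∀ a b : complexBetti S (2 * 1),
      cupProduct (rfl : 2 * 1 + 2 * 1 = 2 * 2) a b = k3Form (η a) (η b) • p) ∧
    IsOfHodgeType 2 S (2 * 1) 2 0 (LinearEquiv.symm η x) ∧
    (∀ τ : complexBetti S (2 * 1), IsOfHodgeType 2 S (2 * 1) 2 0 τ →
      ∃ t : ℂ, τ = t • LinearEquiv.symm η x)) ∧
    (k3Form x x = 0 ∧ 0 < (k3Form (star x) x).re ∧
      ∃ u : K3Index → ℤ, k3Form (fun i => (u i : ℂ)) x = 0 ∧ 0 < ∑ i, ∑ j, u i * k3Gram i j * u j))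

/-! ### The rational transcendental space of a marked K3 surface of Picard rank `≥ 11` -/

/-- **The marked transcendental data at Picard rank `≥ 11`.** For a marked projective K3 surface
`(S, η, p, x)` with `ρ(S) ≥ 11` there is a subspace `T ⊂ Λ_ℚ` (`T = N_ℚ^⊥`, `N_ℚ` the rational
`(1,1)`-vectors) with: the K3 form non-degenerate on `T`, `dim T ≤ 11`, and the period `x` and its
conjugate `x̄` in the complex span of `T`. Proof through the marking: `N_ℚ = {u : (u.x) = (u.x̄) = 0}`
(Lefschetz `(1,1)`, `N¹ ⊆ H^{1,1}`, the K3 Hodge types `Huybrechts_K3_hodgeTypes_H2_holds`),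
`N_ℚ ∩ N_ℚ^⊥ = 0` (Hodge index, `anchorExistence_cmFloor_divisorClass_eq_zero_of_hodgeIndex`),
`dim_ℚ N_ℚ ≥ dim_ℂ N¹H²(S) ≥ 11` (`N¹` is spanned by rational classes), and
`x ∈ N_ℚ^⊥ ⊗ ℂ` (`cxEnd_projection_eq_zero`, `iota_lam_of_proj_eq_zero`).
[cite: Huybrechts2016K3, Ch. 3 Lemma 3.3.1 and Ch. 6 Prop. 1.2] [cite: VoisinHodgeI2002, Thm. 11.30 and Thm. 6.32] -/
theorem exists_transcendentalRat (hS : IsK3Surface S)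
    (η : complexBetti S (2 * 1) ≃ₗ[ℂ] (K3Index → ℂ)) (p : complexBetti S (2 * 2)) (x : K3Index → ℂ)
    (hM : MarkedK3[S, η, p, x]) (hρ : 11 ≤ Module.finrank ℂ ↥(algebraicClasses S 1)) :
    ∃ T : Submodule ℚ (K3Index → ℚ),
      (∀ t ∈ T, (∀ t' ∈ T, k3FormRat t t' = 0) → t = 0) ∧ Module.finrank ℚ T ≤ 11 ∧
      x ∈ Submodule.span ℂ (Set.range fun t : T => fun i => ((t : K3Index → ℚ) i : ℂ)) ∧
      star x ∈ Submodule.span ℂ (Set.range fun t : T => fun i => ((t : K3Index → ℚ) i : ℂ)) := by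
  classical
  have hHT : Huybrechts_K3_hodgeTypes_H2 := Huybrechts_K3_hodgeTypes_H2_holds
  obtain ⟨hp₀, ⟨-, -, hηint, hηcup, hx20, -⟩, -, hxpos, -⟩ := hM
  set N := algebraicClasses S 1 with hNdef
  set σ := η.symm x with hσdef
  have hησ : η σ = x := by rw [hσdef, LinearEquiv.apply_symm_apply]
  have hxne : σ ≠ 0 := fun h0 => ne_zero_of_star_self_re_pos hxpos (by rw [← hησ, h0, map_zero])
  obtain ⟨-, -, h₃⟩ := hHT S hS σ hx20 hxne
  have hσbar : conjClass (ComplexPoints S) (2 * 1) σ = η.symm (star x) :=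
    conjClass_marking_symm η hηint x
  have hsmul0 : ∀ {c : ℂ}, c • p = 0 → c = 0 := fun h => by
    rcases smul_eq_zero.1 h with h | h
    · exact h
    · exact absurd h hp₀
  have hL11 : ∀ c : complexBetti S (2 * 1), IsRationalClass c → IsOfHodgeType 2 S (2 * 1) 1 1 c → c ∈ N :=
    fun c hc h11 => lefschetzOneOne_rational_holds hS.1 c hc h11
  have hND : ∀ c ∈ N, IsRationalClass c →
      (∀ d ∈ N, cupProduct (rfl : 2 * 1 + 2 * 1 = 2 * 2) c d = 0) → c = 0 :=
    fun c hcN hc hperp => anchorExistence_cmFloor_divisorClass_eq_zero_of_hodgeIndex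
      hodgeIndex_surface_holds lefschetzOneOne_rational_holds
      Grothendieck1969_supportedClasses_le_hodgeConiveau_holds hS hcN hc hperp
  -- rational classes are `Λ_ℚ`
  have hrat : ∀ c, IsRationalClass c ↔ ∃ w : K3Index → ℚ, η c = fun i => (w i : ℂ) :=
    isRationalClass_iff_of_marking hS η hηint
  -- the rational points of `N`
  let NQ : Submodule ℚ (K3Index → ℚ) :=
    { carrier := {u | η.symm (fun j => (u j : ℂ)) ∈ N}
      add_mem' := fun {u v} hu hv => by
        simp only [Set.mem_setOf_eq, ratCastΛ_add, map_add]
        exact N.add_mem hu hv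
      zero_mem' := by
        simp only [Set.mem_setOf_eq, ratCastΛ_zero, map_zero]
        exact N.zero_mem
      smul_mem' := fun q u hu => by
        simp only [Set.mem_setOf_eq, ratCastΛ_smul, map_smul]
        exact N.smul_mem _ hu }
  have memNQ : ∀ u, u ∈ NQ ↔ η.symm (fun j => (u j : ℂ)) ∈ N := fun u => Iff.rfl
  -- `(1,1)`-classes through the marking
  have h11_iff : ∀ v : K3Index → ℂ, IsOfHodgeType 2 S (2 * 1) 1 1 (η.symm v) ↔
      (k3Form v x = 0 ∧ k3Form v (star x) = 0) := by
    intro v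
    rw [h₃ (η.symm v), hηcup, hηcup, LinearEquiv.apply_symm_apply, hησ, hσbar, LinearEquiv.apply_symm_apply]
    constructor
    · rintro ⟨ha, hb⟩
      exact ⟨hsmul0 ha, hsmul0 hb⟩
    · rintro ⟨ha, hb⟩
      rw [ha, hb, zero_smul]
      exact ⟨rfl, rfl⟩
  -- `N_ℚ = Λ_ℚ ∩ {x, x̄}^⊥`
  have hN : ∀ u : K3Index → ℚ, u ∈ NQ ↔
      (k3Form (fun i => (u i : ℂ)) x = 0 ∧ k3Form (fun i => (u i : ℂ)) (star x) = 0) := by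
    intro u
    rw [memNQ, ← h11_iff]
    constructor
    · intro hu
      exact isOfHodgeType_of_mem_algebraicClasses_of_isSmoothProjective hS.1 1 hu
    · intro hu
      exact hL11 _ ((hrat _).2 ⟨u, LinearEquiv.apply_symm_apply _ _⟩) hu
  -- `N` is spanned by its rational classes, so `N_ℚ^⊥ ⊗ ℂ ⊥ N`
  have hspan := span_isRationalClass_eq_top_of_isSmoothProjective_holds.supportedClasses_eq_span
    hS.1 (2 * 1) 1
  have horth : ∀ u ∈ k3FormRat.orthogonal NQ, ∀ d ∈ N, k3Form (fun j => (u j : ℂ)) (η d) = 0 := by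
    intro u hu d hd
    rw [LinearMap.BilinForm.mem_orthogonal_iff] at hu
    have hd' : d ∈ Submodule.span ℂ {c : complexBetti S (2 * 1) |
        IsRationalClass c ∧ c ∈ supportedClasses S (2 * 1) 1} := by
      rw [← hspan]; exact hd
    clear hd
    induction hd' using Submodule.span_induction with
    | mem d hd =>
      obtain ⟨w, hw⟩ := (hrat d).1 hd.1
      have hwN : w ∈ NQ := by
        rw [memNQ, ← hw, LinearEquiv.symm_apply_apply]
        exact hd.2
      rw [hw, k3Form_ratCast, k3FormRat_isSymm.eq, hu w hwN, Rat.cast_zero]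
    | zero => rw [map_zero, k3Form_zero_right]
    | add c c' _ _ hc hc' => rw [map_add, k3Form_add_right, hc, hc', add_zero]
    | smul t c _ hc => rw [map_smul, k3Form_smul_right, hc, mul_zero]
  -- `N_ℚ ∩ N_ℚ^⊥ = 0` (Hodge index)
  have hdisj : Disjoint NQ (k3FormRat.orthogonal NQ) := by
    rw [Submodule.disjoint_def]
    intro u huN huT
    have hc0 : η.symm (fun j => (u j : ℂ)) = 0 :=
      hND _ ((memNQ u).1 huN) ((hrat _).2 ⟨u, LinearEquiv.apply_symm_apply _ _⟩) fun d hd => by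
        rw [hηcup, LinearEquiv.apply_symm_apply, horth u huT d hd, zero_smul]
    apply ratCastΛ_injective
    rw [ratCastΛ_zero]
    exact η.symm.injective (hc0.trans (map_zero _).symm)
  have hc := isCompl_orthogonal hdisj
  set T := k3FormRat.orthogonal NQ with hTdef
  -- `dim_ℚ N_ℚ ≥ dim_ℂ N ≥ 11`, hence `dim_ℚ T ≤ 11`
  have hdimN : Module.finrank ℂ ↥N ≤ Module.finrank ℚ ↥NQ := by
    let b := Module.finBasis ℚ NQ
    let c : Fin (Module.finrank ℚ ↥NQ) → complexBetti S (2 * 1) :=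
      fun i => η.symm (fun j => (((b i : NQ) : K3Index → ℚ) j : ℂ))
    have hle : N ≤ Submodule.span ℂ (Set.range c) := by
      intro d hd
      have hd' : d ∈ Submodule.span ℂ {c : complexBetti S (2 * 1) |
          IsRationalClass c ∧ c ∈ supportedClasses S (2 * 1) 1} := by
        rw [← hspan]; exact hd
      refine Submodule.span_le.2 ?_ hd'
      rintro d ⟨hdQ, hdN⟩
      obtain ⟨w, hw⟩ := (hrat d).1 hdQ
      have hwN : w ∈ NQ := by
        rw [memNQ, ← hw, LinearEquiv.symm_apply_apply]
        exact hdN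
      have hd_eq : d = η.symm (fun j => (w j : ℂ)) := by rw [← hw, LinearEquiv.symm_apply_apply]
      have hw_eq : (w : K3Index → ℚ) = ∑ i, (b.repr ⟨w, hwN⟩ i) • ((b i : NQ) : K3Index → ℚ) := by
        have h := congrArg (fun t : NQ => (t : K3Index → ℚ)) (b.sum_repr ⟨w, hwN⟩).symm
        simpa only [Submodule.coe_sum, Submodule.coe_smul] using h
      rw [SetLike.mem_coe, hd_eq, hw_eq, ratCastΛ_sum, map_sum]
      refine Submodule.sum_mem _ fun i _ => ?_
      rw [ratCastΛ_smul, map_smul]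
      exact Submodule.smul_mem _ _ (Submodule.subset_span ⟨i, rfl⟩)
    haveI : Module.Finite ℂ ↥(Submodule.span ℂ (Set.range c)) :=
      Module.Finite.span_of_finite ℂ (Set.finite_range c)
    exact (Submodule.finrank_mono hle).trans ((finrank_range_le_card c).trans (by simp))
  have hdimT : Module.finrank ℚ ↥T ≤ 11 := by
    rw [hTdef, LinearMap.BilinForm.finrank_orthogonal k3FormRat_nondegenerate, finrank_k3Rat]
    omega
  -- `T` is non-degenerate
  have hTnd : ∀ t ∈ T, (∀ t' ∈ T, k3FormRat t t' = 0) → t = 0 := by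
    intro t ht hperp
    have hdisj' := disjoint_orthogonal_orthogonal hdisj
    rw [Submodule.disjoint_def] at hdisj'
    refine hdisj' t ht ?_
    rw [LinearMap.BilinForm.mem_orthogonal_iff]
    intro t' ht'
    change k3FormRat t' t = 0
    rw [k3FormRat_isSymm.eq]
    exact hperp t' ht'
  -- `x, x̄ ∈ T ⊗ ℂ`
  have hxT : ∀ z : K3Index → ℂ, (∀ n ∈ NQ, k3Form z (fun i => (n i : ℂ)) = 0) →
      z ∈ Submodule.span ℂ (Set.range fun t : T => fun i => ((t : K3Index → ℚ) i : ℂ)) := by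
    intro z hz
    have hz0 := cxEnd_projection_eq_zero hdisj hz
    have h := iota_lam_of_proj_eq_zero (T := T) (hc := hc) hz0
    rw [← h]
    exact iota_mem_span T _
  refine ⟨T, hTnd, hdimT, hxT x fun n hn => ?_, hxT (star x) fun n hn => ?_⟩
  · rw [k3Form_comm]
    exact ((hN n).1 hn).1
  · rw [k3Form_comm]
    exact ((hN n).1 hn).2

/-! ### The isogenous marked K3 surface with the anti-invariant `E₈(−2)` in its Néron–Severi lattice -/

/-- The rational vector underlying an anti-invariant lattice vector is of the form `(y, −y; 0)`.
[cite: VanGeemenSarti2007, §1.3 ("`{(0,x,−x)}`")] -/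
theorem ratCast_eq_of_mem_nikulinAntiInvariant {v : K3Index → ℤ} (hv : v ∈ nikulinAntiInvariant) :
    (fun i => ((v i : ℚ) : ℚ)) =
      (Sum.elim (Sum.elim (fun a => (v (Sum.inl (Sum.inl a)) : ℚ))
        (-fun a => (v (Sum.inl (Sum.inl a)) : ℚ))) (0 : Fin 2 ⊕ (Fin 2 ⊕ Fin 2) → ℚ) : K3Index → ℚ) := by
  obtain ⟨h1, h2⟩ := (mem_nikulinAntiInvariant_iff v).1 hv
  funext i
  rcases i with (a | a) | b
  · rfl
  · simp only [Sum.elim_inl, Sum.elim_inr, Pi.neg_apply, h1 a, Int.cast_neg]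
  · simp only [Sum.elim_inr, Pi.zero_apply, h2 b, Int.cast_zero]

/-- **Every marked projective K3 surface of Picard rank `≥ 11` is isogenous to one whose Néron–Severi
lattice contains the anti-invariant `E₈(−2)` of the model Nikulin involution** (mod the surjectivity
of the period map). For `(S, η, p, x)` marked projective with `ρ(S) ≥ 11` there are: a projective K3
surface `S'` with a marking `(η', p', x')` satisfying the crux's marking clause, an isometry `σ` of
`(Λ_ℂ, k3Form)` defined over `ℚ` with `σ x' = x` — so `S'` is isogenous to `S` and
`HodgeConjectureFor 4 (S ⊗ S) ↔ HodgeConjectureFor 4 (S' ⊗ S')` (mod Buskin,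
`hodgeConjectureFor_square_iff_of_markedIsometry`) — and `η'⁻¹(v) ∈ algebraicClasses S' 1` for every
`v` in the anti-invariant lattice `nikulinAntiInvariant = {(y, −y; 0)} ≅ E₈(−2)` (primitive in `Λ`,
van Geemen–Sarti §1.3). Proof: `exists_transcendentalRat`, the lattice lemma
`exists_isometryEquiv_orthogonal_antidiagE8` (complexified by `cxEnd`), `exists_markedK3_ratIsometry`,
and Lefschetz `(1,1)` on `S'` read through the marking (`x' = σ₀ x ⊥ E₈(−2)_{antidiag}` together with
`x̄'`). This discharges the lattice hypothesis `T(X) ↪ U³_ℚ ⊕ E₈(−2)_ℚ` of Varesco's Prop. 2.5 at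
`ρ ≥ 11`. [cite: Varesco2023, §2 Prop. 2.5 and its proof] [cite: VanGeemenSarti2007, §1.3 and §2.1]
[cite: Kitaoka1993, Ch. 4 Cor. 4.1.4] [cite: Huybrechts2016K3, Ch. 7 Thm. 4.1 and Ch. 6 Rem. 3.3] -/
theorem exists_isogenous_antiInvariant_algebraic (hPS : Huybrechts_K3_periodSurjective_projective)
    (hS : IsK3Surface S)
    (η : complexBetti S (2 * 1) ≃ₗ[ℂ] (K3Index → ℂ)) (p : complexBetti S (2 * 2)) (x : K3Index → ℂ)
    (hM : MarkedK3[S, η, p, x]) (hρ : 11 ≤ Module.finrank ℂ ↥(algebraicClasses S 1)) :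
    ∃ (S' : SchemeOver ℂ) (_ : IsK3Surface S') (η' : complexBetti S' (2 * 1) ≃ₗ[ℂ] (K3Index → ℂ))
      (p' : complexBetti S' (2 * 2)) (x' : K3Index → ℂ) (σ : Module.End ℂ (K3Index → ℂ)),
      MarkedK3[S', η', p', x'] ∧ (∀ a b, k3Form (σ a) (σ b) = k3Form a b) ∧
      (∀ v : K3Index → ℤ, ∃ w : K3Index → ℚ, σ (fun i => (v i : ℂ)) = fun i => (w i : ℂ)) ∧
      σ x' = x ∧
      ∀ v ∈ nikulinAntiInvariant, η'.symm (fun i => ((v i : ℤ) : ℂ)) ∈ algebraicClasses S' 1 := by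
  classical
  have hHT : Huybrechts_K3_hodgeTypes_H2 := Huybrechts_K3_hodgeTypes_H2_holds
  obtain ⟨T, hTnd, hdimT, hxT, hxbarT⟩ := exists_transcendentalRat hS η p x hM hρ
  -- the rational isometry moving `T` into `(E₈(−2)_{antidiag})^⊥`, complexified
  obtain ⟨σL, hσL⟩ := exists_isometryEquiv_orthogonal_antidiagE8 T hTnd hdimT
  set τ : Module.End ℚ (K3Index → ℚ) :=
    ((σL : (K3Index → ℚ) ≃ₗ[ℚ] (K3Index → ℚ)) : (K3Index → ℚ) →ₗ[ℚ] (K3Index → ℚ)) with hτ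
  have hτapp : ∀ v, τ v = σL v := fun v => rfl
  have hτiso : ∀ v w, k3FormRat (τ v) (τ w) = k3FormRat v w := fun v w => by
    rw [hτapp, hτapp]
    exact σL.map_app w v
  set σ₀ : Module.End ℂ (K3Index → ℂ) := cxEnd τ with hσ₀
  have hσ₀iso : ∀ a b, k3Form (σ₀ a) (σ₀ b) = k3Form a b := k3Form_cxEnd τ hτiso
  have hσ₀rat : ∀ v : K3Index → ℤ, ∃ w : K3Index → ℚ, σ₀ (fun i => (v i : ℂ)) = fun i => (w i : ℂ) :=
    cxEnd_intCast τ
  -- the marked projective K3 surface at the period `σ₀ x`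
  obtain ⟨S', hS', η', p', hM'⟩ := exists_markedK3_ratIsometry hPS σ₀ hσ₀iso hσ₀rat hM.2.2
  -- the isogeny `σ = σ₀⁻¹`
  obtain ⟨σ, -, hσσ₀, hσiso, hσrat⟩ := exists_inverse_ratIsometry σ₀ hσ₀iso hσ₀rat
  refine ⟨S', hS', η', p', σ₀ x, σ, hM', hσiso, hσrat, hσσ₀ x, fun v hv => ?_⟩
  -- `η'⁻¹(v)` is an integral `(1,1)`-class of `S'`, hence algebraic
  obtain ⟨hp'0, ⟨-, -, hη'int, hη'cup, hx'20, -⟩, -, hx'pos, -⟩ := hM'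
  have hint : IsIntegralClass (η'.symm (fun i => ((v i : ℤ) : ℂ))) :=
    (hη'int _).2 ⟨v, η'.apply_symm_apply _⟩
  refine lefschetzOneOne_rational_holds hS'.1 _ hint.isRationalClass ?_
  -- `(1,1)` on `S'` ⟺ orthogonal to `σ₀ x` and `\overline{σ₀ x}`
  set σ' := η'.symm (σ₀ x) with hσ'def
  have hx'ne : σ' ≠ 0 := fun h0 =>
    ne_zero_of_star_self_re_pos hx'pos (by rw [← η'.apply_symm_apply (σ₀ x), ← hσ'def, h0, map_zero])
  obtain ⟨-, -, h₃'⟩ := hHT S' hS' σ' hx'20 hx'ne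
  have hσ'bar : conjClass (ComplexPoints S') (2 * 1) σ' = η'.symm (star (σ₀ x)) :=
    conjClass_marking_symm η' hη'int (σ₀ x)
  rw [h₃', hη'cup, hη'cup, LinearEquiv.apply_symm_apply, hσ'def, LinearEquiv.apply_symm_apply, hσ'bar,
    LinearEquiv.apply_symm_apply]
  -- the anti-diagonal vector is orthogonal to `σ₀ z` for every `z ∈ T ⊗ ℂ`
  have hvQ := ratCast_eq_of_mem_nikulinAntiInvariant hv
  have horthT : ∀ z ∈ Submodule.span ℂ (Set.range fun t : T => fun i => ((t : K3Index → ℚ) i : ℂ)),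
      k3Form (fun i => ((v i : ℤ) : ℂ)) (σ₀ z) = 0 := by
    intro z hz
    induction hz using Submodule.span_induction with
    | mem z hz =>
      obtain ⟨t, rfl⟩ := hz
      rw [hσ₀, cxEnd_ratCast, intCast_eq_ratCast_intCast, k3Form_ratCast, hvQ, hτapp,
        hσL t t.2, Rat.cast_zero]
    | zero => rw [map_zero, k3Form_zero_right]
    | add a b _ _ ha hb => rw [map_add, k3Form_add_right, ha, hb, add_zero]
    | smul c a _ ha => rw [map_smul, k3Form_smul_right, ha, mul_zero]
  have h1 : k3Form (fun i => ((v i : ℤ) : ℂ)) (σ₀ x) = 0 := horthT x hxT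
  have h2 : k3Form (fun i => ((v i : ℤ) : ℂ)) (star (σ₀ x)) = 0 := by
    rw [hσ₀, ← cxEnd_star]
    exact horthT (star x) hxbarT
  rw [h1, h2, zero_smul]
  exact ⟨rfl, rfl⟩

end Summit.HodgeConjecture.HodgeConjecture.Theorems.MarkmanPartnerTransport.NikulinIsogeny

end
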